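import Literature.NumberTheory.EllipticCurves.Kramer1981.FiniteFieldTwoTorsionDiscriminant
import Literature.NumberTheory.EllipticCurves.Kramer1981.KernelReductionTwoDivisible
import Literature.NumberTheory.EllipticCurves.Kramer1981.LocalNormCokernel
import Literature.NumberTheory.EllipticCurves.Kramer1981.RamifiedNormIndexLocalLemmas
import Literature.NumberTheory.EllipticCurves.KramerTunnell1982.UnramifiedNormIndex
import Literature.NumberTheory.EllipticCurves.VariableChangePointsMap
import Mathlib.AlgebraicGeometry.EllipticCurve.Reduction
import HarnessLib

/-!
# Kramer 1981 §2 Prop. 3 — the norm index at a ramified odd place of good reduction (proof)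

K. Kramer, *Arithmetic of elliptic curves upon quadratic extension*, Trans. AMS 264 (1981), §2,
Proposition 3 (p. 125): "Suppose that `K` over `F` is a ramified extension with residue field `k`
having odd characteristic. If `E` has good reduction modulo `π_F` then `i(K/F) = dim E(k)_2`.
Moreover `i(K/F)` is even or odd according to whether `(Δ, d)_F = ±1`."  Here
`2^{i(K/F)} = #(E(F)/N E(K))`.  The named fact `prop3_ramifiedOddGoodNormIndex` of
`Kramer1981/LocalNormCokernel.lean` types it (with `E(F)` rendered as the `σ`-fixed subgroup
`E(K')^σ` of `E(K')`, `K' = F(√d) ⊆ F̄`); this file PROVES it: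
`prop3_ramifiedOddGoodNormIndex_holds`.  Only theorems are added (D-0026: no new definitions, no
new named facts); no `sorry`; axioms standard.

## The printed proof and its rendering

Kramer (p. 125): "Let `E₁` denote the kernel of reduction … By [8, Cor. 4.6] we have the exact
sequence `E₁(F)/N E₁(K) → E(F)/N E(K) → E(k)/2E(k) → 0`. Since `E₁(F)` is uniquely divisible by
`2` [15, p. 189] and the composition `E₁(F) → E₁(K) → E₁(F)` (inclusion, then norm) is
multiplication by `2`, the left group is trivial. Hence `i(K/F) = dim E(k)/2E(k) = dim E(k)_2`.
… `dim E(k)_2` is even precisely when `Δ` becomes a square in `k` [9, p. 305], equivalently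
`(Δ, d)_F = 1`."  The tree renders the four ingredients as follows (`W` = the integral minimal
model over `𝒪[F]`, unit discriminant; `ι : E(F) →+ E(K')` the base change):

1. `E(K')^σ = ι E(F)` — Galois descent for points of the quadratic extension `K' = F(√d)`
   (`range_baseChange_eq_fixedSubgroup_quadratic`; Kramer–Tunnell use `E(F)/N E(K) = H¹(G, E(K))`).
2. `E(K') = ι E(F) + E₁(K')` (the surjectivity in [8, Cor. 4.6]): `K'/F` is totally ramified, so
   an integral point of `E(K')` is congruent modulo `𝔪_{K'}` to integral coordinates from `F`
   (`RamifiedNormIndexLocalLemmas.exists_algNorm_sub_algebraMap_lt_one`), its reduction is a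
   point of the good reduction `Ẽ(k)`, which lifts to `E(F)` by Hensel's lemma
   (`exists_equation_residue_eq`); the difference lies in `E₁(K')` (the reduction map of the tree
   file `PointReduction` is additive on integral points).
3. `N E(K') = ι(2 E(F))` (`normSubgroup_eq_map_range_two_ramified`): for `Q = ι P + D`,
   `D ∈ E₁(K')`, `N Q = 2 ι P + (D + σD)` with `D + σD ∈ E₁(K')^σ = ι E₁(F)`, and `E₁(F) ⊆ 2 E₁(F)`
   (`KernelReductionTwoDivisible.exists_two_nsmul_eq_of_reducesToZero`, "`E₁(F)` is uniquely
   divisible by `2`"). Hence `#(E(K')^σ/N E(K')) = [E(F) : 2E(F)] = #Ẽ(k)[2]`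
   (`KernelReductionTwoDivisible.index_range_two_eq_card_torsionBy_two`;
   `relIndex_norm_fixed_eq_card_torsionBy_two`).
4. `#Ẽ(k)[2] = 2^i` with `i` even iff `Δ̄` is a square in `k`
   (`FiniteFieldTwoTorsionDiscriminant.exists_natCard_torsionBy_two_eq_two_pow`, [9, p. 305]) iff
   `(Δ, d)_F = 1` for `v(d)` odd
   (`RamifiedNormIndexLocalLemmas.hilbertSymbol_eq_one_iff_isSquare_residue`).

The statement is about an arbitrary elliptic `E/F` and the reduction of its minimal model
`E.minimal 𝒪[F] = C • E`; the norm index is transported along `E(K') ≃+ (C • E)(K')`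
(`relIndex_norm_fixed_smul`).  The absolute value of `K' ⊆ F̄` is the tree's `algNorm F`
(produced as a valuation `w'`, `exists_valuation_intermediateField`).  Cell `bsd-uniform`
(seat ue-lit GEN 13), discharging a typed input of track U2/UE
(`pub/bsd-uniform/u2/INGREDIENTS.md`).

## References

* [Kramer1981] K. Kramer, *Arithmetic of elliptic curves upon quadratic extension*, Trans. Amer.
  Math. Soc. 264 (1981) 121–135, §2 Prop. 3 (p. 125) and its proof.
* [KramerTunnell1982] K. Kramer, J. Tunnell, *Elliptic curves and local ε-factors*, Compositio
  Math. 46 (1982) 307–352, §5 (proof of Prop. 5.11: `E(F) = E(K)^G`).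
* [SilvermanAEC2009] J. H. Silverman, *The Arithmetic of Elliptic Curves*, 2nd ed., GTM 106
  (2009), III.3.1(b), VII.2.1–2.2.
* [NeukirchANT1999] J. Neukirch, *Algebraic Number Theory*, Springer (1999), Ch. II (4.8).
-/

noncomputable section

open scoped Classical NNReal
open ValuativeRel Field
open Literature.NumberTheory.GaloisRepresentations
open Literature.NumberTheory.GaloisRepresentations.IsNonarchimedeanLocalField
open Literature.NumberTheory.EllipticCurves.KramerTunnell1982
open _root_.WeierstrassCurve _root_.WeierstrassCurve.Affine
open Literature.NumberTheory.EllipticCurves.FormalGroupChart (kernel some_mem_kernel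
  some_mem_kernel_iff)

namespace Literature.NumberTheory.EllipticCurves.Kramer1981

variable {F : Type} [Field F] [ValuativeRel F] [TopologicalSpace F] [IsNonarchimedeanLocalField F]

/-- For a rank-one valuation `w` on a field `L`, the residue of `z ∈ 𝒪_w` vanishes iff
`w z < 1`. [folklore] -/
private theorem residue_integer_eq_zero_iff {L : Type*} [Field L] {w : Valuation L ℝ≥0}
    (z : w.integer) : IsLocalRing.residue w.integer z = 0 ↔ w (z : L) < 1 := by
  rw [IsLocalRing.residue_eq_zero_iff, IsLocalRing.mem_maximalIdeal, mem_nonunits_iff,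
    Valuation.Integer.not_isUnit_iff_valuation_lt_one]

/-! ## §1 The absolute value of `K'` and the integral model over its valuation ring -/

section KPrime

variable (K' : IntermediateField F (AlgebraicClosure F))

/-- **The absolute value of `K' ⊆ F̄` as a real valuation** (the tree's `algNorm F` restricted to
`K'`: multiplicative, ultrametric; Neukirch *ANT* II (4.8)). Produced existentially; no definition.
[cite: NeukirchANT1999, Ch. II (4.8)] -/
theorem exists_valuation_intermediateField :
    ∃ w' : Valuation K' ℝ≥0, ∀ y : K', (w' y : ℝ) = algNorm F (y : AlgebraicClosure F) := by
  refine ⟨{ toFun := fun y => ⟨algNorm F (y : AlgebraicClosure F), algNorm_nonneg _⟩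
            map_zero' := ?_, map_one' := ?_, map_mul' := ?_, map_add_le_max' := ?_ },
    fun y => rfl⟩
  · apply Subtype.ext
    change algNorm F ((0 : K') : AlgebraicClosure F) = 0
    rw [ZeroMemClass.coe_zero]
    exact algNorm_eq_zero_iff.mpr rfl
  · apply Subtype.ext
    change algNorm F ((1 : K') : AlgebraicClosure F) = 1
    rw [OneMemClass.coe_one, algNorm_one]
  · intro y z
    apply Subtype.ext
    change algNorm F ((y * z : K') : AlgebraicClosure F) =
      algNorm F (y : AlgebraicClosure F) * algNorm F (z : AlgebraicClosure F)
    rw [MulMemClass.coe_mul, algNorm_mul]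
  · intro y z
    rw [← NNReal.coe_le_coe, NNReal.coe_max]
    change algNorm F ((y + z : K') : AlgebraicClosure F) ≤
      max (algNorm F (y : AlgebraicClosure F)) (algNorm F (z : AlgebraicClosure F))
    rw [AddMemClass.coe_add]
    exact algNorm_add_le _ _

variable {K'} {w' : Valuation K' ℝ≥0}
  (hw' : ∀ y : K', (w' y : ℝ) = algNorm F (y : AlgebraicClosure F))
include hw'

/-- `w'` on `F`: `w' a ≤ 1 ↔ a ∈ 𝒪[F]`. [folklore] -/
private theorem w'_algebraMap_le_one_iff (a : F) : w' (algebraMap F K' a) ≤ 1 ↔ a ∈ 𝒪[F] := by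
  rw [← NNReal.coe_le_coe, hw', NNReal.coe_one]
  exact algNorm_algebraMap_le_one_iff

/-- `w'` on `F`: `w' a < 1 ↔ v(a) < 1`. [folklore] -/
private theorem w'_algebraMap_lt_one_iff (a : F) :
    w' (algebraMap F K' a) < 1 ↔ valuation F a < 1 := by
  rw [← NNReal.coe_lt_coe, hw', NNReal.coe_one]
  exact algNorm_algebraMap_lt_one_iff

/-- For `t ∈ 𝒪[F]`: `w' t < 1 ↔ t ∈ 𝓂[F]`. [folklore] -/
private theorem w'_coe_lt_one_iff (t : 𝒪[F]) : w' (algebraMap F K' t) < 1 ↔ t ∈ 𝓂[F] := by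
  rw [w'_algebraMap_lt_one_iff hw', mem_maximalIdeal_iff]

/-- For `t ∈ 𝒪[F]`: `w' t ≤ 1`. [folklore] -/
private theorem w'_coe_le_one (t : 𝒪[F]) : w' (algebraMap F K' t) ≤ 1 :=
  (w'_algebraMap_le_one_iff hw' _).mpr t.2

/-- For `t ∈ 𝒪[F]`: `w' t = 1 ↔ t` is a unit. [folklore] -/
private theorem w'_coe_eq_one_iff (t : 𝒪[F]) : w' (algebraMap F K' t) = 1 ↔ IsUnit t := by
  rw [isUnit_integer_iff]
  have h1 := w'_coe_le_one hw' t
  have h2 : valuation F (t : F) ≤ 1 := t.2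
  have h3 := w'_algebraMap_lt_one_iff hw' (t : F)
  constructor
  · intro h
    by_contra hne
    have := h3.mpr (lt_of_le_of_ne h2 hne)
    rw [h] at this
    exact lt_irrefl _ this
  · intro h
    by_contra hne
    have := h3.mp (lt_of_le_of_ne h1 hne)
    rw [h] at this
    exact lt_irrefl _ this

/-- `1 < w' a ↔ 1 < v(a)` for `a ∈ F`. [folklore] -/
private theorem one_lt_w'_algebraMap_iff (a : F) :
    1 < w' (algebraMap F K' a) ↔ 1 < valuation F a := by
  rw [← not_le, w'_algebraMap_le_one_iff hw', ← not_le]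
  exact Iff.rfl

/-- **`Aut(K'/F)` acts on `K'` by isometries**: `w' (σ y) = w' y`. [folklore] -/
private theorem w'_algEquiv (σ : K' ≃ₐ[F] K') (y : K') : w' (σ y) = w' y := by
  apply NNReal.coe_injective
  rw [hw', hw']
  exact algNorm_algEquiv σ y

/-- **The ring homomorphism `𝒪[F] → 𝒪_{w'}`** (restriction of `F → K'` to the valuation rings).
Produced existentially. [folklore] -/
private theorem exists_ringHom_integer :
    ∃ φ : 𝒪[F] →+* w'.integer, ∀ t : 𝒪[F], ((φ t : w'.integer) : K') = algebraMap F K' t := by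
  refine ⟨{ toFun := fun t => ⟨algebraMap F K' t, (w'_coe_le_one hw' t)⟩
            map_one' := ?_, map_mul' := ?_, map_zero' := ?_, map_add' := ?_ }, fun t => rfl⟩
  · apply Subtype.ext; simp
  · intro a b; apply Subtype.ext; simp
  · apply Subtype.ext; simp
  · intro a b; apply Subtype.ext; simp

variable (W : WeierstrassCurve 𝒪[F])

/-- For a Weierstrass equation `W` over `𝒪[F]`, `W ⊗ K'` is `w'`-integral. [folklore] -/
private theorem isIntegral_baseChange_baseChange :
    ((W.baseChange F).baseChange K').IsIntegral w'.integer := by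
  refine isIntegral_of_exists_lift _ ?_ ?_ ?_ ?_ ?_
  · exact ⟨⟨algebraMap F K' (W.a₁ : F), w'_coe_le_one hw' _⟩, rfl⟩
  · exact ⟨⟨algebraMap F K' (W.a₂ : F), w'_coe_le_one hw' _⟩, rfl⟩
  · exact ⟨⟨algebraMap F K' (W.a₃ : F), w'_coe_le_one hw' _⟩, rfl⟩
  · exact ⟨⟨algebraMap F K' (W.a₄ : F), w'_coe_le_one hw' _⟩, rfl⟩
  · exact ⟨⟨algebraMap F K' (W.a₆ : F), w'_coe_le_one hw' _⟩, rfl⟩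

/-- Under good reduction (`Δ ∈ 𝒪[F]ˣ`), `w' Δ(W ⊗ K') = 1`. [folklore] -/
private theorem w'_Δ_eq_one (hΔ : IsUnit W.Δ) : w' ((W.baseChange F).baseChange K').Δ = 1 := by
  have h1 : ((W.baseChange F).baseChange K').Δ = algebraMap F K' (W.baseChange F).Δ :=
    (W.baseChange F).map_Δ _
  have h2 : (W.baseChange F).Δ = algebraMap 𝒪[F] F W.Δ := W.map_Δ _
  rw [h1, h2]
  exact (w'_coe_eq_one_iff hw' W.Δ).mpr hΔ

end KPrime

/-! ## §2 Galois descent for `K' = F(√d)`: `E(K')^σ = ι E(F)` -/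

section Descent

variable {K' : IntermediateField F (AlgebraicClosure F)}

omit [ValuativeRel F] [TopologicalSpace F] [IsNonarchimedeanLocalField F] in
/-- An `F`-automorphism acts through its underlying algebra homomorphism. [folklore] -/
private theorem algHom_coe_apply (σ : K' ≃ₐ[F] K') (z : K') : (σ : K' →ₐ[F] K') z = σ z := rfl

omit [ValuativeRel F] [TopologicalSpace F] [IsNonarchimedeanLocalField F] in
/-- The non-trivial `F`-automorphism of the quadratic extension `K' = F(√d)` is an involution
(`σ(a + b x) = a - b x`). [folklore] -/
private theorem algEquiv_mul_self (h2 : Module.finrank F K' = 2) {d : F} (hd : ¬ IsSquare d)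
    {x : K'} (hx : x ^ 2 = algebraMap F K' d) {σ : K' ≃ₐ[F] K'} (hσ : σ ≠ 1) : σ * σ = 1 := by
  have hσx : σ x = -x := algEquiv_apply_eq_neg h2 hd hx hσ
  ext y
  obtain ⟨a, b, rfl⟩ := exists_eq_add_mul h2 hd hx y
  simp only [AlgEquiv.mul_apply, AlgEquiv.one_apply, map_add, map_mul, AlgEquiv.commutes, hσx,
    map_neg, neg_neg]

omit [ValuativeRel F] [TopologicalSpace F] [IsNonarchimedeanLocalField F] in
/-- For an involution `σ`, `σ ∘ σ = id` on `E(K')`. [folklore] -/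
private theorem map_map_self (V : WeierstrassCurve F) {σ : K' ≃ₐ[F] K'} (hσσ : σ * σ = 1)
    (Q : (V.baseChange K').toAffine.Point) :
    Affine.Point.map (W' := V) (σ : K' →ₐ[F] K')
        (Affine.Point.map (W' := V) (σ : K' →ₐ[F] K') Q) = Q := by
  rcases Q with _ | ⟨u, v, h⟩
  · rfl
  · rw [Affine.Point.map_some, Affine.Point.map_some]
    refine point_some_eq_some ?_ ?_ <;>
      simp only [algHom_coe_apply, ← AlgEquiv.mul_apply, hσσ, AlgEquiv.one_apply]

omit [ValuativeRel F] [TopologicalSpace F] [IsNonarchimedeanLocalField F] in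
/-- **Galois descent for points over the quadratic extension `K' = F(√d)`**: a point of `E(K')`
fixed by the non-trivial automorphism `σ` has coordinates in `F` (`exists_eq_algebraMap_of_fixed`),
so it is the image of a point of `E(F)` — the inclusion `E(K)^G ⊆ E(F)` used throughout by Kramer
and Kramer–Tunnell (`E(F)/N E(K) = H¹(G, E(K))` needs `E(K)^G = E(F)`).
[cite: KramerTunnell1982, §5 proof of Prop. 5.11 (p. 326), E(F) = E(K)^G] -/
theorem exists_baseChange_eq_of_map_eq [CharZero F] (V : WeierstrassCurve F)
    (h2 : Module.finrank F K' = 2) {d : F} (hd : ¬ IsSquare d) {x : K'}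
    (hx : x ^ 2 = algebraMap F K' d) {σ : K' ≃ₐ[F] K'} (hσ : σ ≠ 1)
    {Q : (V.baseChange K').toAffine.Point}
    (hQ : Affine.Point.map (W' := V) (σ : K' →ₐ[F] K') Q = Q) :
    ∃ P : (V.baseChange F).toAffine.Point, Affine.Point.baseChange (W' := V) F K' P = Q := by
  rcases Q with _ | ⟨u, v, h⟩
  · exact ⟨0, rfl⟩
  · rw [Affine.Point.map_some] at hQ
    simp only [Affine.Point.some.injEq, algHom_coe_apply] at hQ
    obtain ⟨a, rfl⟩ : ∃ a : F, Algebra.ofId F K' a = u :=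
      let ⟨a, ha⟩ := exists_eq_algebraMap_of_fixed h2 hd hx hσ hQ.1; ⟨a, ha.symm⟩
    obtain ⟨b, rfl⟩ : ∃ b : F, Algebra.ofId F K' b = v :=
      let ⟨b, hb⟩ := exists_eq_algebraMap_of_fixed h2 hd hx hσ hQ.2; ⟨b, hb.symm⟩
    exact ⟨Affine.Point.some a b
      ((V.toAffine.baseChange_nonsingular (Algebra.ofId F K').injective a b).mp h), by
        rw [Affine.Point.baseChange, Affine.Point.map_some]⟩

omit [ValuativeRel F] [TopologicalSpace F] [IsNonarchimedeanLocalField F] in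
/-- **`E(K')^σ = ι(E(F))`** for the quadratic extension `K' = F(√d)`: the subgroup of `E(K')` fixed
by `σ` is the range of the base change `ι : E(F) →+ E(K')` (Galois descent one way, Mathlib
`Point.map_baseChange` the other).
[cite: KramerTunnell1982, §5 proof of Prop. 5.11 (p. 326), E(F) = E(K)^G] -/
theorem range_baseChange_eq_fixedSubgroup_quadratic [CharZero F] (V : WeierstrassCurve F)
    (h2 : Module.finrank F K' = 2) {d : F} (hd : ¬ IsSquare d) {x : K'}
    (hx : x ^ 2 = algebraMap F K' d) {σ : K' ≃ₐ[F] K'} (hσ : σ ≠ 1) :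
    (Affine.Point.baseChange (W' := V) F K').range = fixedSubgroup V K' σ := by
  ext Q
  constructor
  · rintro ⟨P, rfl⟩
    exact mem_fixedSubgroup_iff.mpr (Affine.Point.map_baseChange _ P)
  · intro hQ
    exact exists_baseChange_eq_of_map_eq V h2 hd hx hσ (mem_fixedSubgroup_iff.mp hQ)

end Descent

/-! ## §3 `E(K') = ι E(F) + E₁(K')` and `N E(K') = ι(2 E(F))` for a ramified `K'` (Kramer p. 125)

The kernel of reduction `E₁(K')` is handled through the reduction map `P ↦ P̃` of the tree file
`PointReduction` (`reducePoint`; `P ∈ E₁ ↔ P̃ = Õ`), and through the subgroup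
`FormalGroupChart.kernel` only inside the generic lemmas below. -/

section KernelOfReduction

variable {L : Type*} [Field L] {w : Valuation L ℝ≥0} {k : Type*} [Field k] {r : w.integer →+* k}
  {V : WeierstrassCurve L} [V.IsIntegral w.integer]

/-- On a `w`-integral Weierstrass equation with `w Δ = 1`, a point with reduction `Õ` lies in the
kernel of reduction `E₁` (Silverman, *AEC*, VII.2.1, `ker = E₁`). [folklore] -/
private theorem mem_kernel_of_reducePoint_eq_zero
    (hr : ∀ a : w.integer, r a = 0 ↔ w (a : L) < 1) (hΔ : w V.Δ = 1) {Vt : WeierstrassCurve k}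
    (hVt : reduceCurve r V = Vt) {P : V.toAffine.Point} (hP : reducePoint w r Vt P = 0) :
    P ∈ kernel w V := by
  rcases P with _ | ⟨x, y, h⟩
  · exact (kernel w V).zero_mem
  · by_cases hx : w x ≤ 1
    · exact absurd hP (reducePoint_some_ne_zero hr hΔ hVt h hx)
    · exact some_mem_kernel h (not_le.mp hx)

/-- An affine point with reduction `Õ` has `|x| > 1` (`w Δ = 1`). [folklore] -/
private theorem one_lt_of_reducePoint_some_eq_zero
    (hr : ∀ a : w.integer, r a = 0 ↔ w (a : L) < 1) (hΔ : w V.Δ = 1) {Vt : WeierstrassCurve k}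
    (hVt : reduceCurve r V = Vt) {x y : L} {h : V.toAffine.Nonsingular x y}
    (h0 : reducePoint w r Vt (.some x y h) = 0) : 1 < w x := by
  by_contra hx
  exact reducePoint_some_ne_zero hr hΔ hVt h (not_lt.mp hx) h0

/-- Points of `E₁` reduce to `Õ`. [folklore] -/
private theorem reducePoint_eq_zero_of_mem_kernel {Vt : WeierstrassCurve k} {P : V.toAffine.Point}
    (hP : P ∈ kernel w V) : reducePoint w r Vt P = 0 := by
  rcases P with _ | ⟨x, y, h⟩
  · rfl
  · exact reducePoint_some_of_one_lt ((some_mem_kernel_iff (w := w) h).mp hP)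

/-- **`E₁` is a subgroup**, phrased with the reduction map: if `P̃ = Q̃ = Õ` then
`(P + Q)~ = Õ` (Silverman, *AEC*, Prop. VII.2.2; the tree's `FormalGroupChart.kernel`).
[folklore] -/
private theorem reducePoint_add_eq_zero
    (hr : ∀ a : w.integer, r a = 0 ↔ w (a : L) < 1) (hΔ : w V.Δ = 1) {Vt : WeierstrassCurve k}
    (hVt : reduceCurve r V = Vt) {P Q : V.toAffine.Point} (hP : reducePoint w r Vt P = 0)
    (hQ : reducePoint w r Vt Q = 0) : reducePoint w r Vt (P + Q) = 0 :=
  reducePoint_eq_zero_of_mem_kernel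
    ((kernel w V).add_mem (mem_kernel_of_reducePoint_eq_zero hr hΔ hVt hP)
      (mem_kernel_of_reducePoint_eq_zero hr hΔ hVt hQ))

end KernelOfReduction

section Ramified

variable {K' : IntermediateField F (AlgebraicClosure F)} {w' : Valuation K' ℝ≥0}
  (hw' : ∀ y : K', (w' y : ℝ) = algNorm F (y : AlgebraicClosure F))
include hw'

/-- In a RAMIFIED quadratic extension `K' = F(√d)` of odd residue characteristic the residue field
does not grow: every `w'`-integral `y ∈ K'` is congruent modulo `𝔪_{K'}` to an element of `𝒪[F]`
(`exists_algNorm_sub_algebraMap_lt_one`, with `v(d)` odd by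
`valuation_mul_sq_ne_one_of_not_le_maxUnramified`). [folklore] -/
private theorem exists_w'_sub_algebraMap_lt_one (hodd : ringChar 𝓀[F] ≠ 2)
    (h2 : Module.finrank F K' = 2) (hram : ¬ K' ≤ maxUnramified F) {d : F} (hd : ¬ IsSquare d)
    {x : K'} (hx : x ^ 2 = algebraMap F K' d) {y : K'} (hy : w' y ≤ 1) :
    ∃ a : 𝒪[F], w' (y - algebraMap F K' a) < 1 := by
  have hd' : ∀ c : F, valuation F (d * c ^ 2) ≠ 1 :=
    valuation_mul_sq_ne_one_of_not_le_maxUnramified hodd h2 hram hd hx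
  have hy' : algNorm F (y : AlgebraicClosure F) ≤ 1 := by
    rw [← hw', ← NNReal.coe_one, NNReal.coe_le_coe]; exact hy
  obtain ⟨a, ha⟩ := exists_algNorm_sub_algebraMap_lt_one h2 hd hd' hx hy'
  refine ⟨a, ?_⟩
  rw [← NNReal.coe_lt_coe, hw', NNReal.coe_one, AddSubgroupClass.coe_sub]
  exact ha

/-- **The `K'`-side residue equation.** If an integral point `(x_Q, y_Q)` of `W ⊗ K'` has
coordinates congruent modulo `𝔪_{K'}` to `a, b ∈ 𝒪[F]`, then `(ā, b̄)` lies on the reduction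
`W̃ = W mod 𝓂[F]`: reduce the equation modulo `𝔪_{K'}` (`equation_reduceFun`) and pull it back
along the embedding of residue fields `k ↪ k'`. [folklore] -/
private theorem equation_residue_of_congr (W : WeierstrassCurve 𝒪[F]) {xQ yQ : K'}
    (he : ((W.baseChange F).baseChange K').toAffine.Equation xQ yQ) (hxQ : w' xQ ≤ 1)
    (hyQ : w' yQ ≤ 1) {a b : 𝒪[F]} (ha : w' (xQ - algebraMap F K' a) < 1)
    (hb : w' (yQ - algebraMap F K' b) < 1) :
    (W.map (IsLocalRing.residue 𝒪[F])).toAffine.Equation (IsLocalRing.residue 𝒪[F] a)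
      (IsLocalRing.residue 𝒪[F] b) := by
  haveI := isIntegral_baseChange_baseChange hw' W
  obtain ⟨φ, hφ⟩ := exists_ringHom_integer hw'
  have hr : ∀ z : w'.integer, IsLocalRing.residue w'.integer z = 0 ↔ w' (z : K') < 1 :=
    residue_integer_eq_zero_iff
  -- `W ⊗ K'` is the base change of the model `W.map φ` over `𝒪_{w'}`
  have hV : (W.map φ).baseChange K' = (W.baseChange F).baseChange K' := by
    simp only [WeierstrassCurve.baseChange, WeierstrassCurve.map_map]
    congr 1
    refine RingHom.ext fun t => ?_
    rw [RingHom.comp_apply, RingHom.comp_apply]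
    exact hφ t
  -- reduce the equation of `(x_Q, y_Q)` modulo `𝔪_{K'}`
  have heq := equation_reduceFun (r := IsLocalRing.residue w'.integer) he hxQ hyQ
  rw [← hV, reduceCurve_baseChange, WeierstrassCurve.map_map] at heq
  have hxa : reduceFun (IsLocalRing.residue w'.integer) xQ =
      IsLocalRing.residue w'.integer (φ a) := by
    rw [(reduceFun_eq_iff hr hxQ (w'_coe_le_one hw' a)).mpr ha, ← hφ, reduceFun_coe]
  have hyb : reduceFun (IsLocalRing.residue w'.integer) yQ =
      IsLocalRing.residue w'.integer (φ b) := by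
    rw [(reduceFun_eq_iff hr hyQ (w'_coe_le_one hw' b)).mpr hb, ← hφ, reduceFun_coe]
  rw [hxa, hyb] at heq
  -- `𝒪[F] → 𝒪_{w'} → k'` kills `𝓂[F]`, so it factors through an embedding `ψ : k ↪ k'`
  have hker : ∀ t ∈ 𝓂[F], ((IsLocalRing.residue w'.integer).comp φ) t = 0 := by
    intro t ht
    rw [RingHom.comp_apply, hr, hφ]
    exact (w'_coe_lt_one_iff hw' t).mpr ht
  obtain ⟨ψ, hψ⟩ : ∃ ψ : 𝓀[F] →+* IsLocalRing.ResidueField w'.integer,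
      ∀ t : 𝒪[F], ψ (IsLocalRing.residue 𝒪[F] t) = IsLocalRing.residue w'.integer (φ t) :=
    ⟨Ideal.Quotient.lift (IsLocalRing.maximalIdeal 𝒪[F]) _ hker,
      fun t => Ideal.Quotient.lift_mk _ _ _⟩
  have hcomp : (IsLocalRing.residue w'.integer).comp φ = ψ.comp (IsLocalRing.residue 𝒪[F]) :=
    RingHom.ext fun t => (hψ t).symm
  rw [hcomp, ← WeierstrassCurve.map_map, ← hψ, ← hψ] at heq
  exact (Affine.map_equation _ ψ.injective _ _).mp heq

/-- `σ ∈ Aut(K'/F)` preserves the kernel of reduction `E₁(K')` (it acts by isometries): if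
`D̃ = Õ` then `(σD)~ = Õ`. [folklore] -/
private theorem reducePoint_map_eq_zero (W : WeierstrassCurve 𝒪[F]) (hΔ : IsUnit W.Δ)
    [((W.baseChange F).baseChange K').IsIntegral w'.integer] (σ : K' ≃ₐ[F] K')
    {D : ((W.baseChange F).baseChange K').toAffine.Point}
    (hD : reducePoint w' (IsLocalRing.residue w'.integer)
      (reduceCurve (IsLocalRing.residue w'.integer) ((W.baseChange F).baseChange K')) D = 0) :
    reducePoint w' (IsLocalRing.residue w'.integer)
      (reduceCurve (IsLocalRing.residue w'.integer) ((W.baseChange F).baseChange K'))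
      (Affine.Point.map (W' := W.baseChange F) (σ : K' →ₐ[F] K') D) = 0 := by
  rcases D with _ | ⟨u, v, h⟩
  · rfl
  · have hu : 1 < w' u :=
      one_lt_of_reducePoint_some_eq_zero residue_integer_eq_zero_iff (w'_Δ_eq_one hw' W hΔ) rfl hD
    have hσu : 1 < w' ((σ : K' →ₐ[F] K') u) := by rwa [algHom_coe_apply, w'_algEquiv hw']
    rw [Affine.Point.map_some]
    exact reducePoint_some_of_one_lt hσu

/-- If `(ι P)~ = Õ` for an `F`-point `P`, then `P ∈ E₁(F)` (`|x(P)|` is read in `F`). [folklore] -/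
private theorem reducesToZero_of_reducePoint_baseChange_eq_zero (W : WeierstrassCurve 𝒪[F])
    (hΔ : IsUnit W.Δ) [((W.baseChange F).baseChange K').IsIntegral w'.integer]
    {P : ((W.baseChange F).baseChange F).toAffine.Point}
    (hP : reducePoint w' (IsLocalRing.residue w'.integer)
      (reduceCurve (IsLocalRing.residue w'.integer) ((W.baseChange F).baseChange K'))
      (Affine.Point.baseChange (W' := W.baseChange F) F K' P) = 0) :
    WeierstrassCurve.ReducesToZero (K := F) W P := by
  rcases P with _ | ⟨u, v, h⟩
  · exact WeierstrassCurve.reducesToZero_zero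
  · rw [Affine.Point.baseChange, Affine.Point.map_some] at hP
    have hu :=
      one_lt_of_reducePoint_some_eq_zero residue_integer_eq_zero_iff (w'_Δ_eq_one hw' W hΔ) rfl hP
    rw [Algebra.ofId_apply, one_lt_w'_algebraMap_iff hw'] at hu
    show u ∉ Set.range (algebraMap 𝒪[F] F)
    exact (not_mem_range_iff (Valuation.integer.integers (valuation F))).mpr hu

/-- **`E(K') = ι E(F) + E₁(K')`** for a ramified quadratic `K' = F(√d)`, odd residue
characteristic, good reduction (the surjectivity in Mazur's sequence [8, Cor. 4.6] as used by
Kramer, p. 125, made explicit): an integral point `Q = (x_Q, y_Q)` of `E(K')` has coordinates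
congruent mod `𝔪_{K'}` to `a, b ∈ 𝒪[F]` (`f(K'/F) = 1`); `(ā, b̄)` is a point of the good
reduction `Ẽ(k)`, which lifts by Hensel's lemma (`exists_equation_residue_eq`) to `P ∈ E(F)`
with `P̃ = Q̃`; then
`D = Q - ι P` reduces to `Õ`, i.e. lies in `E₁(K')` (`reducePoint_add`).
[cite: Kramer1981, §2 proof of Prop. 3 (p. 125), the exact sequence of [8, Cor. 4.6]] -/
private theorem exists_eq_baseChange_add_of_reducePoint_eq_zero (hodd : ringChar 𝓀[F] ≠ 2)
    (h2 : Module.finrank F K' = 2) (hram : ¬ K' ≤ maxUnramified F) {d : F} (hd : ¬ IsSquare d)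
    {x : K'} (hx : x ^ 2 = algebraMap F K' d) (W : WeierstrassCurve 𝒪[F]) (hΔ : IsUnit W.Δ)
    [((W.baseChange F).baseChange K').IsIntegral w'.integer]
    (Q : ((W.baseChange F).baseChange K').toAffine.Point) :
    ∃ (P : ((W.baseChange F).baseChange F).toAffine.Point)
      (D : ((W.baseChange F).baseChange K').toAffine.Point),
      reducePoint w' (IsLocalRing.residue w'.integer)
          (reduceCurve (IsLocalRing.residue w'.integer) ((W.baseChange F).baseChange K')) D = 0 ∧
        Q = Affine.Point.baseChange (W' := W.baseChange F) F K' P + D := by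
  have hΔ' := w'_Δ_eq_one hw' W hΔ
  have hr : ∀ z : w'.integer, IsLocalRing.residue w'.integer z = 0 ↔ w' (z : K') < 1 :=
    residue_integer_eq_zero_iff
  rcases Q with _ | ⟨xQ, yQ, hQ⟩
  · exact ⟨0, 0, rfl, by rw [← Affine.Point.zero_def, map_zero, add_zero]⟩
  by_cases hxQ : w' xQ ≤ 1
  swap
  · exact ⟨0, .some xQ yQ hQ, reducePoint_some_of_one_lt (not_le.mp hxQ),
      by rw [map_zero, zero_add]⟩
  -- an integral point: approximate its coordinates in `𝒪[F]`
  have hyQ : w' yQ ≤ 1 := val_y_le_one hQ.1 hxQ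
  obtain ⟨a, ha⟩ := exists_w'_sub_algebraMap_lt_one hw' hodd h2 hram hd hx hxQ
  obtain ⟨b, hb⟩ := exists_w'_sub_algebraMap_lt_one hw' hodd h2 hram hd hx hyQ
  -- `(ā, b̄)` is a (nonsingular) point of the good reduction `W̃`
  have hΔt : (W.map (IsLocalRing.residue 𝒪[F])).Δ ≠ 0 := by
    rw [WeierstrassCurve.map_Δ]; exact (hΔ.map _).ne_zero
  have hns : (W.map (IsLocalRing.residue 𝒪[F])).toAffine.Nonsingular
      (IsLocalRing.residue 𝒪[F] a) (IsLocalRing.residue 𝒪[F] b) :=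
    (Affine.equation_iff_nonsingular_of_Δ_ne_zero hΔt).mp
      (equation_residue_of_congr hw' W hQ.1 hxQ hyQ ha hb)
  -- Hensel: lift `(ā, b̄)` to an `𝒪[F]`-point `(a', b')` of `W`
  haveI : HenselianLocalRing 𝒪[F] := henselianLocalRing_integer
  obtain ⟨a', b', hab', ha', hb'⟩ := W.exists_equation_residue_eq hns
  have hΔF : ((W.baseChange F).baseChange F).Δ ≠ 0 := by
    have h1 : ((W.baseChange F).baseChange F).Δ = algebraMap F F (W.baseChange F).Δ :=
      (W.baseChange F).map_Δ _
    have h1' : (W.baseChange F).Δ = algebraMap 𝒪[F] F W.Δ := W.map_Δ _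
    rw [h1, h1']
    exact ((hΔ.map _).map _).ne_zero
  have hPeq : ((W.baseChange F).baseChange F).toAffine.Equation (a' : F) (b' : F) := by
    rw [WeierstrassCurve.baseChange, Algebra.algebraMap_self, WeierstrassCurve.map_id,
      WeierstrassCurve.baseChange]
    exact (Affine.map_equation _ (IsFractionRing.injective 𝒪[F] F) _ _).mpr hab'
  have hPns : ((W.baseChange F).baseChange F).toAffine.Nonsingular (a' : F) (b' : F) :=
    (Affine.equation_iff_nonsingular_of_Δ_ne_zero hΔF).mp hPeq
  -- the congruences `x_Q ≡ a'`, `y_Q ≡ b'` modulo `𝔪_{K'}`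
  have hcong : ∀ {z : K'} {c c' : 𝒪[F]}, w' (z - algebraMap F K' c) < 1 →
      IsLocalRing.residue 𝒪[F] c' = IsLocalRing.residue 𝒪[F] c →
      w' (z - algebraMap F K' c') < 1 := by
    intro z c c' hz hcc'
    have hmem : c - c' ∈ 𝓂[F] := Ideal.Quotient.eq.mp hcc'.symm
    have h2' : w' (algebraMap F K' c - algebraMap F K' c') < 1 := by
      rw [← map_sub, ← AddSubgroupClass.coe_sub]
      exact (w'_coe_lt_one_iff hw' (c - c')).mpr hmem
    rw [← sub_add_sub_cancel z (algebraMap F K' c) (algebraMap F K' c')]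
    exact w'.map_add_lt hz h2'
  have ha'' := hcong ha ha'
  have hb'' := hcong hb hb'
  -- reduction modulo `𝔪_{K'}`: `Q` and `ι P` have the same reduction, so `(Q - ι P)~ = Õ`
  have hι : Affine.Point.baseChange (W' := W.baseChange F) F K' (.some _ _ hPns) =
      .some (algebraMap F K' a') (algebraMap F K' b')
        (((W.baseChange F).toAffine.baseChange_nonsingular
          (Algebra.ofId F K').injective _ _).mpr hPns) := by
    rw [Affine.Point.baseChange, Affine.Point.map_some]; rfl
  have hQint :
      IsIntegralPoint w' (.some xQ yQ hQ : ((W.baseChange F).baseChange K').toAffine.Point) := hxQ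
  have hιint : IsIntegralPoint w' (-Affine.Point.baseChange (W' := W.baseChange F) F K'
      (.some _ _ hPns)) := by
    rw [isIntegralPoint_neg_iff, hι]; exact w'_coe_le_one hw' a'
  -- additivity of reduction on integral points (the tree's `reducePoint_add`, up to the
  -- `DecidableEq` instance implicit in the group law on `E(K')`)
  have hadd : reducePoint w' (IsLocalRing.residue w'.integer)
      (reduceCurve (IsLocalRing.residue w'.integer) ((W.baseChange F).baseChange K'))
      (.some xQ yQ hQ + -Affine.Point.baseChange (W' := W.baseChange F) F K' (.some _ _ hPns)) =
      reducePoint w' (IsLocalRing.residue w'.integer)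
        (reduceCurve (IsLocalRing.residue w'.integer) ((W.baseChange F).baseChange K'))
        (.some xQ yQ hQ) +
      reducePoint w' (IsLocalRing.residue w'.integer)
        (reduceCurve (IsLocalRing.residue w'.integer) ((W.baseChange F).baseChange K'))
        (-Affine.Point.baseChange (W' := W.baseChange F) F K' (.some _ _ hPns)) := by
    convert reducePoint_add hr hΔ' rfl hQint hιint
  have hred : reducePoint w' (IsLocalRing.residue w'.integer)
      (reduceCurve (IsLocalRing.residue w'.integer) ((W.baseChange F).baseChange K'))
      (.some xQ yQ hQ - Affine.Point.baseChange (W' := W.baseChange F) F K' (.some _ _ hPns)) =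
      0 := by
    rw [sub_eq_add_neg, hadd, reducePoint_neg rfl, hι, reducePoint_some hr hΔ' rfl hQ hxQ,
      reducePoint_some hr hΔ' rfl _ (w'_coe_le_one hw' a'), ← sub_eq_add_neg, sub_eq_zero]
    exact point_some_eq_some
      ((reduceFun_eq_iff hr hxQ (w'_coe_le_one hw' a')).mpr ha'')
      ((reduceFun_eq_iff hr hyQ (w'_coe_le_one hw' b')).mpr hb'')
  exact ⟨.some _ _ hPns, _, hred, by abel⟩

end Ramified

section NormIndex

variable {K' : IntermediateField F (AlgebraicClosure F)}

/-- **`N E(K') = ι(2 E(F))`** for a ramified quadratic `K' = F(√d)` at an odd place of good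
reduction (Kramer p. 125: in the exact sequence `E₁(F)/N E₁(K) → E(F)/N E(K) → E(k)/2E(k) → 0`
of [8, Cor. 4.6] the left group vanishes since `E₁(F)` is `2`-divisible and `N ∘ incl = 2`).
Proof: write `Q = ι P + D` with `D ∈ E₁(K')` (`E(K') = ι E(F) + E₁(K')`); then
`N Q = 2 ι P + (D + σD)` and `D + σD ∈ E₁(K')^σ = ι E₁(F) = ι (2 E₁(F))`
(`exists_two_nsmul_eq_of_reducesToZero`); conversely `ι(2P) = ι P + σ ι P`.
[cite: Kramer1981, §2 proof of Prop. 3 (p. 125)] -/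
theorem normSubgroup_eq_map_range_two_ramified [CharZero F] (hodd : ringChar 𝓀[F] ≠ 2)
    (W : WeierstrassCurve 𝒪[F]) (hΔ : IsUnit W.Δ) (h2 : Module.finrank F K' = 2)
    (hram : ¬ K' ≤ maxUnramified F) {d : F} (hd : ¬ IsSquare d) {x : K'}
    (hx : x ^ 2 = algebraMap F K' d) {σ : K' ≃ₐ[F] K'} (hσ : σ ≠ 1) :
    normSubgroup (W.baseChange F) K' σ =
      ((nsmulAddMonoidHom 2 :
          ((W.baseChange F).baseChange F).toAffine.Point →+ _).range).map
        (Affine.Point.baseChange (W' := W.baseChange F) F K') := by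
  obtain ⟨w', hw'⟩ := exists_valuation_intermediateField K'
  haveI := isIntegral_baseChange_baseChange hw' W
  have hΔ' := w'_Δ_eq_one hw' W hΔ
  have hσσ : σ * σ = 1 := algEquiv_mul_self h2 hd hx hσ
  ext Q
  constructor
  · intro hQ
    obtain ⟨Q₁, rfl⟩ := mem_normSubgroup_iff.mp hQ
    obtain ⟨P, D, hD, rfl⟩ :=
      exists_eq_baseChange_add_of_reducePoint_eq_zero hw' hodd h2 hram hd hx W hΔ Q₁
    -- `S = D + σD ∈ E₁(K')` is fixed by `σ`, hence `S = ι P₂` with `P₂ ∈ E₁(F) = 2 E₁(F)`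
    have hS : reducePoint w' (IsLocalRing.residue w'.integer)
        (reduceCurve (IsLocalRing.residue w'.integer) ((W.baseChange F).baseChange K'))
        (D + Affine.Point.map (W' := W.baseChange F) (σ : K' →ₐ[F] K') D) = 0 := by
      convert reducePoint_add_eq_zero residue_integer_eq_zero_iff hΔ' rfl hD
        (reducePoint_map_eq_zero hw' W hΔ σ hD)
    have hSfix : Affine.Point.map (W' := W.baseChange F) (σ : K' →ₐ[F] K')
        (D + Affine.Point.map (W' := W.baseChange F) (σ : K' →ₐ[F] K') D) =
        D + Affine.Point.map (W' := W.baseChange F) (σ : K' →ₐ[F] K') D := by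
      rw [map_add, map_map_self _ hσσ, add_comm]
    obtain ⟨P₂, hP₂⟩ := exists_baseChange_eq_of_map_eq (W.baseChange F) h2 hd hx hσ hSfix
    have hP₂0 : WeierstrassCurve.ReducesToZero (K := F) W P₂ :=
      reducesToZero_of_reducePoint_baseChange_eq_zero hw' W hΔ (by rw [hP₂]; exact hS)
    obtain ⟨Q₂, -, hQ₂⟩ := exists_two_nsmul_eq_of_reducesToZero hodd W hΔ hP₂0
    obtain ⟨Q₃, hQ₃⟩ : ∃ Q₃ : ((W.baseChange F).baseChange F).toAffine.Point, 2 • Q₃ = P₂ :=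
      ⟨Q₂, hQ₂⟩
    have hιQ₃ : 2 • Affine.Point.baseChange (W' := W.baseChange F) F K' Q₃ =
        D + Affine.Point.map (W' := W.baseChange F) (σ : K' →ₐ[F] K') D := by
      rw [← map_nsmul, hQ₃, hP₂]
    refine ⟨2 • (P + Q₃), ⟨P + Q₃, rfl⟩, ?_⟩
    rw [map_nsmul, map_add, smul_add, hιQ₃, map_add, Affine.Point.map_baseChange, two_nsmul]
    abel
  · rintro ⟨_, ⟨P₀, rfl⟩, rfl⟩
    refine mem_normSubgroup_iff.mpr ⟨Affine.Point.baseChange (W' := W.baseChange F) F K' P₀, ?_⟩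
    rw [Affine.Point.map_baseChange, nsmulAddMonoidHom_apply, map_nsmul, two_nsmul]

/-- **"`i(K/F) = dim E(k)/2E(k) = dim E(k)_2`"** (Kramer 1981, Prop. 3, first clause, p. 125): for a
ramified quadratic `K' = F(√d)`, odd residue characteristic, and a Weierstrass equation `W` over
`𝒪[F]` with unit discriminant, `#(E(K')^σ / N E(K')) = #Ẽ(k)[2]`: transport along the injective
`ι : E(F) →+ E(K')` (`E(K')^σ = ι E(F)`, `N E(K') = ι 2E(F)`) to `[E(F) : 2E(F)]`, which is
`#Ẽ(k)[2]` (`index_range_two_eq_card_torsionBy_two`). [cite: Kramer1981, §2 Prop. 3 (p. 125)] -/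
theorem relIndex_norm_fixed_eq_card_torsionBy_two [CharZero F] (hodd : ringChar 𝓀[F] ≠ 2)
    (W : WeierstrassCurve 𝒪[F]) (hΔ : IsUnit W.Δ) (h2 : Module.finrank F K' = 2)
    (hram : ¬ K' ≤ maxUnramified F) {d : F} (hd : ¬ IsSquare d) {x : K'}
    (hx : x ^ 2 = algebraMap F K' d) {σ : K' ≃ₐ[F] K'} (hσ : σ ≠ 1) :
    (normSubgroup (W.baseChange F) K' σ).relIndex (fixedSubgroup (W.baseChange F) K' σ) =
      Nat.card
        (AddSubgroup.torsionBy (W.map (IsLocalRing.residue 𝒪[F])).toAffine.Point (2 : ℤ)) := by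
  rw [normSubgroup_eq_map_range_two_ramified hodd W hΔ h2 hram hd hx hσ,
    ← range_baseChange_eq_fixedSubgroup_quadratic (W.baseChange F) h2 hd hx hσ,
    AddMonoidHom.range_eq_map (Affine.Point.baseChange (W' := W.baseChange F) F K'),
    AddSubgroup.relIndex_map_map_of_injective _ _
      (Affine.Point.map_injective (W' := W.baseChange F) (Algebra.ofId F K')),
    AddSubgroup.relIndex_top_right]
  exact index_range_two_eq_card_torsionBy_two hodd W hΔ

end NormIndex

/-! ## §4 Change of model and the proof of Proposition 3 -/

section Transport

variable {L : Type*} [Field L] [Algebra F L] [DecidableEq L]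

omit [ValuativeRel F] [TopologicalSpace F] [IsNonarchimedeanLocalField F] in
/-- **The norm index does not depend on the Weierstrass model**: for a change of variables `C`
over `F`, the isomorphism `E(L) ≃+ (C • E)(L)` (`VariableChange.pointEquivBaseChange`, Silverman
III.3.1(b)) commutes with `σ ∈ Aut(L/F)` (`pointEquivBaseChange_map_algEquiv`), so it carries
`N E(L)` onto `N (C • E)(L)` and `E(L)^σ` onto `(C • E)(L)^σ`.
[cite: SilvermanAEC2009, III.3.1(b)] -/
theorem relIndex_norm_fixed_smul (E : WeierstrassCurve F) (C : VariableChange F)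
    (σ : L ≃ₐ[F] L) :
    (normSubgroup (C • E) L σ).relIndex (fixedSubgroup (C • E) L σ) =
      (normSubgroup E L σ).relIndex (fixedSubgroup E L σ) := by
  have hN : (normSubgroup E L σ).map
      (VariableChange.pointEquivBaseChange E C L).toAddMonoidHom = normSubgroup (C • E) L σ := by
    ext Q
    simp only [AddSubgroup.mem_map, mem_normSubgroup_iff, AddEquiv.coe_toAddMonoidHom]
    constructor
    · rintro ⟨_, ⟨P, rfl⟩, rfl⟩
      exact ⟨VariableChange.pointEquivBaseChange E C L P, by
        rw [map_add, VariableChange.pointEquivBaseChange_map_algEquiv]⟩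
    · rintro ⟨P₁, rfl⟩
      refine ⟨(VariableChange.pointEquivBaseChange E C L).symm P₁ +
        Affine.Point.map (W' := E) (σ : L →ₐ[F] L)
          ((VariableChange.pointEquivBaseChange E C L).symm P₁), ⟨_, rfl⟩, ?_⟩
      rw [map_add, VariableChange.pointEquivBaseChange_map_algEquiv, AddEquiv.apply_symm_apply]
  have hF : (fixedSubgroup E L σ).map
      (VariableChange.pointEquivBaseChange E C L).toAddMonoidHom = fixedSubgroup (C • E) L σ := by
    ext Q
    simp only [AddSubgroup.mem_map, mem_fixedSubgroup_iff, AddEquiv.coe_toAddMonoidHom]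
    constructor
    · rintro ⟨P, hP, rfl⟩
      rw [← VariableChange.pointEquivBaseChange_map_algEquiv, hP]
    · intro hQ
      refine ⟨(VariableChange.pointEquivBaseChange E C L).symm Q, ?_,
        (VariableChange.pointEquivBaseChange E C L).apply_symm_apply Q⟩
      apply (VariableChange.pointEquivBaseChange E C L).injective
      rw [VariableChange.pointEquivBaseChange_map_algEquiv, AddEquiv.apply_symm_apply, hQ]
  rw [← hN, ← hF, AddSubgroup.relIndex_map_map_of_injective _ _
    (VariableChange.pointEquivBaseChange E C L).injective]

end Transport

/-- `2 ≠ 0` in the residue field when its characteristic is odd. [folklore] -/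
private theorem two_ne_zero_residueField (hodd : ringChar 𝓀[F] ≠ 2) : (2 : 𝓀[F]) ≠ 0 := by
  rw [← map_ofNat (IsLocalRing.residue 𝒪[F]) 2, IsLocalRing.residue_ne_zero_iff_isUnit]
  exact isUnit_two hodd

/-- **Kramer 1981, Proposition 3, PROVED** (discharge of the named fact
`prop3_ramifiedOddGoodNormIndex` of `Kramer1981/LocalNormCokernel.lean`, following Kramer's proof,
p. 125): for `K' = F(√d)` ramified quadratic over a `p`-adic field `F` with `p` odd and `E/F` of
good reduction, `#(E(K')^σ / N E(K')) = #Ẽ(k)[2]`, and writing it `2^i`, `i` is even iff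
`(Δ, d)_F = 1`. Assembly: pass to the minimal model `E.minimal 𝒪[F] = C • E`
(`relIndex_norm_fixed_smul`) and its integral model `W` (unit discriminant by good reduction);
first clause `relIndex_norm_fixed_eq_card_torsionBy_two`; second clause: `#Ẽ(k)[2] = 2^i` with
`i` even iff `Δ̄` is a square in `k` (`exists_natCard_torsionBy_two_eq_two_pow`, [9, p. 305]) iff
`(Δ, d)_F = 1` (`hilbertSymbol_eq_one_iff_isSquare_residue`, `v(d)` odd).
[cite: Kramer1981, §2 Prop. 3 (p. 125)] -/
theorem prop3_ramifiedOddGoodNormIndex_holds : prop3_ramifiedOddGoodNormIndex := by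
  intro F _ _ _ _ _ hodd E _ hgood K' h2 hram σ hσ d hd x hx
  -- the minimal model `E.minimal = C • E` and its integral model `W` over `𝒪[F]`
  obtain ⟨C, hC⟩ : ∃ C : VariableChange F, E.minimal 𝒪[F] = C • E := ⟨_, rfl⟩
  obtain ⟨W, hW⟩ : ∃ W : WeierstrassCurve 𝒪[F], W = (E.minimal 𝒪[F]).integralModel 𝒪[F] :=
    ⟨_, rfl⟩
  have hWV : W.baseChange F = E.minimal 𝒪[F] := by
    rw [hW]; exact WeierstrassCurve.baseChange_integralModel_eq 𝒪[F] _
  have hred : (E.minimal 𝒪[F]).reduction 𝒪[F] = W.map (IsLocalRing.residue 𝒪[F]) := by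
    rw [hW]; rfl
  have hΔE : (E.minimal 𝒪[F]).Δ = (W.Δ : F) := by
    rw [hW]; exact (WeierstrassCurve.integralModel_Δ_eq 𝒪[F] _).symm
  -- good reduction: `W` has unit discriminant
  have hΔ : IsUnit W.Δ := by
    have h := ((WeierstrassCurve.hasGoodReduction_iff_isElliptic_reduction 𝒪[F]).mp hgood).isUnit
    rw [hred, WeierstrassCurve.map_Δ] at h
    exact (isUnit_map_iff (IsLocalRing.residue 𝒪[F]) _).mp h
  rw [hred, hΔE]
  -- first clause on the model `W ⊗ F = E.minimal = C • E`, transported to `E`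
  have key := relIndex_norm_fixed_eq_card_torsionBy_two hodd W hΔ h2 hram hd hx hσ
  rw [hWV, hC, relIndex_norm_fixed_smul] at key
  refine ⟨key, ?_⟩
  -- second clause: `#Ẽ(k)[2] = 2^i`, `i` even iff `Δ̄` is a square in `k` iff `(Δ, d)_F = 1`
  haveI : (W.map (IsLocalRing.residue 𝒪[F])).IsElliptic :=
    ⟨by rw [WeierstrassCurve.map_Δ]; exact hΔ.map _⟩
  obtain ⟨i, hi, hiff⟩ := exists_natCard_torsionBy_two_eq_two_pow
    (W.map (IsLocalRing.residue 𝒪[F])) (two_ne_zero_residueField hodd)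
  refine ⟨i, key.trans hi, hiff.trans ?_⟩
  rw [WeierstrassCurve.map_Δ]
  exact (hilbertSymbol_eq_one_iff_isSquare_residue hodd hΔ
    (valuation_mul_sq_ne_one_of_not_le_maxUnramified hodd h2 hram hd hx)).symm

end Literature.NumberTheory.EllipticCurves.Kramer1981

end
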